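import Literature.MathematicalPhysics.QuantumFieldTheory.Balaban1983to89.B4Sect5Torus

/-!
# `BalabanUV.Beta.GAN24.DirichletExhaustionPrinted` — binder row G-an2-4 / (CONV-C), part P2, PART 7: THE LOCATED STEP AS A
# THEOREM — what B4's Sect. 5 (5.10) AS PRINTED yields when fed an operator η-rate: a HÖLDER transfer with exponent `δ⋆/δ₀ ≤ 1/16`,
# never better than the linear transfer of PARTS 1–6 (unit b2b-balaban-gan24-p2, gen 1, v1)

HONEST FRAMING (cell contract, verbatim): «discharging `BetaPertH` makes Bałaban's UV stability UNCONDITIONAL — a real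
constructive-QFT result; it is NOT the continuum limit and NOT the Clay problem.»  This file is the KERNEL CERTIFICATE of the
deliverable clause «the located step where the printed argument loses the rate» of the coordinator's brief for P2 (GAPS row
G-gan24p2-1 (a)).  In the abstract finite-index-set form of the Sect. 5 Theorem of [Balaban1983RegularityDecay] (unit pv09-g4,
`B4Sect5Torus.sect5_uniform`: pseudo-distance `ρ`, profile `K`, explicit `cSt`/`dSt`, the printed (5.9)/(5.10) with a boundary
POTENTIAL `ω`), an operator closeness `|B| ≤ ε·e^{−δ₀ρ}` with `0 < ε ≤ c₀` can be fed to the PRINTED (5.10) only by hiding the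
smallness in a CONSTANT potential `ω ≡ t`, `e^{−2δ₀t} = ε/c₀`; the printed conclusion then returns
`cSt·(ε/c₀)^{dSt/δ₀}·e^{−dSt·ρ}` — a Hölder modulus with exponent `dSt/δ₀ ≤ 1/16` (`holder_transfer_of_printed510`,
`holderExponent_le`), and for `ε ≤ c₀` this bound is NEVER smaller than the linear one `cSt·(ε/c₀)·e^{−dSt·ρ}`
(`linear_le_holder`).  So: the SHAPE of (CONV-C) survives even by the printed route (a geometric `θ^k` becomes the geometric
`(θ^{dSt/δ₀})^k`), but the ratio degrades; the paper's own (5.26) with the size of `B` carried through (PART 1 `perturb_rate`) is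
linear.  [folklore] bookkeeping on top of `B4Sect5Torus` BY NAME; formalises no printed statement beyond what that module quotes;
instantiates nothing of Bałaban's; NOT `BetaPertH`, NOT continuum, NOT Clay.  «not in print; our proof attempt».

ABSOLUTE RULE (cell, verbatim): «No internally-minted statement may enter as a cited fact. Every hypothesis is either
kernel-proved in this package or a verbatim quotation of a PUBLISHED theorem with page reference. The manuscript(s) under
audit are NOT citable for their own disputed steps — they are the thing under adjudication; programme-internal
(2001/route/tribunal) claims are never citable.»

PRINTED LOCATION (not a hypothesis): [Balaban1983RegularityDecay] p. 594 (5.9)–(5.10), as quoted in `B4Sect5Torus` / PART 1.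

## What this file proves (0 sorry; imports pv09-g4's `B4Sect5Torus` only)
`hyp59_const_potential` (the constant-potential reading of an operator closeness), **`holder_transfer_of_printed510`**,
`holderExponent_le` (`dSt/δ₀ ≤ 1/16`), **`linear_le_holder`** (`ε/c₀ ≤ (ε/c₀)^{dSt/δ₀}` for `0 < ε ≤ c₀`).  NOT summit progress.
-/

namespace Summit.QuantumFields.BalabanUV.Beta.GAN24.DirichletExhaustionPrinted

open Finset Real
open Literature.MathematicalPhysics.QuantumFieldTheory.Balaban1983to89
open B4Sect5Torus (IsPseudoDist SumBound Hyp56 Hyp59 cSt dSt rate cSt_pos dSt_pos rate_le_quarter sect5_uniform)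

noncomputable section

variable {n m : Type*} [Fintype n] [DecidableEq n] [Fintype m] [DecidableEq m]

/-- The smallness-hiding potential: `t = (2δ₀)⁻¹·log(c₀/ε)`, so that `e^{−2δ₀t} = ε/c₀`. -/
def tPot (c₀ δ₀ ε : ℝ) : ℝ := (2 * δ₀)⁻¹ * Real.log (c₀ / ε)

/-- `t ≥ 0` for `0 < ε ≤ c₀`. -/
theorem tPot_nonneg {c₀ δ₀ ε : ℝ} (hδ : 0 < δ₀) (hε : 0 < ε) (hεc : ε ≤ c₀) : 0 ≤ tPot c₀ δ₀ ε := by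
  unfold tPot
  have h1 : 1 ≤ c₀ / ε := by rw [le_div_iff₀ hε]; linarith
  have h2 : 0 ≤ Real.log (c₀ / ε) := Real.log_nonneg h1
  positivity

/-- `e^{−δ₀(t + t)} = ε/c₀`. -/
theorem exp_neg_two_tPot {c₀ δ₀ ε : ℝ} (hδ : 0 < δ₀) (hε : 0 < ε) (hεc : ε ≤ c₀) :
    Real.exp (-(δ₀ * (tPot c₀ δ₀ ε + tPot c₀ δ₀ ε))) = ε / c₀ := by
  have hc : 0 < c₀ := lt_of_lt_of_le hε hεc
  unfold tPot
  have : -(δ₀ * ((2 * δ₀)⁻¹ * Real.log (c₀ / ε) + (2 * δ₀)⁻¹ * Real.log (c₀ / ε))) = Real.log (ε / c₀) := by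
    rw [Real.log_div hc.ne' hε.ne', Real.log_div hε.ne' hc.ne']
    field_simp
    ring
  rw [this, Real.exp_log (div_pos hε hc)]

omit [Fintype n] [DecidableEq n] in
/-- **The constant-potential reading**: an operator closeness `|B(p,q)| ≤ ε·e^{−δ₀ρ(p,q)}` with `0 < ε ≤ c₀` IS the printed (5.9)
with the constant boundary potential `ω ≡ t`, `t = (2δ₀)⁻¹log(c₀/ε)`: `|B| ≤ c₀e^{−δ₀(ρ + t + t)}`. -/
theorem hyp59_const_potential {ρ : n → n → ℝ} {B : Matrix n n ℝ} {c₀ δ₀ ε : ℝ} (hδ : 0 < δ₀) (hε : 0 < ε)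
    (hεc : ε ≤ c₀) (hB : ∀ p q, |B p q| ≤ ε * Real.exp (-(δ₀ * ρ p q))) :
    Hyp59 ρ (fun _ => tPot c₀ δ₀ ε) B c₀ δ₀ := by
  intro p q
  have hc : 0 < c₀ := lt_of_lt_of_le hε hεc
  have key : c₀ * Real.exp (-(δ₀ * (ρ p q + tPot c₀ δ₀ ε + tPot c₀ δ₀ ε))) = ε * Real.exp (-(δ₀ * ρ p q)) := by
    rw [show -(δ₀ * (ρ p q + tPot c₀ δ₀ ε + tPot c₀ δ₀ ε)) =
        -(δ₀ * ρ p q) + -(δ₀ * (tPot c₀ δ₀ ε + tPot c₀ δ₀ ε)) by ring, Real.exp_add, exp_neg_two_tPot hδ hε hεc]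
    field_simp
  rw [key]
  exact hB p q

/-- **THE HÖLDER TRANSFER OF THE PRINTED (5.10).**  In the abstract Sect. 5 setting of `B4Sect5Torus` (finite index set, pseudo-distance
`ρ`, lattice-sum profile `K`): if `A` and `A + B` satisfy (5.6) with `(γ₀, c₀, δ₀)` and `|B| ≤ ε·e^{−δ₀ρ}` with `0 < ε ≤ c₀`, then the
printed (5.10), applied with the constant potential `ω ≡ (2δ₀)⁻¹log(c₀/ε)`, yields for every compression along an injection `e`:
`|A_Λ⁻¹(i,j) − (A+B)_Λ⁻¹(i,j)| ≤ cSt·(ε/c₀)^{dSt/δ₀}·e^{−dSt·ρ(i,j)}` — smallness enters with the EXPONENT `dSt/δ₀` only. -/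
theorem holder_transfer_of_printed510 {K : ℝ → ℝ} (hK : ∀ a, 0 < a → 0 ≤ K a) {γ₀ c₀ δ₀ : ℝ} (hγ : 0 < γ₀)
    (hc : 0 < c₀) (hδ : 0 < δ₀) {ρ : n → n → ℝ} (hρ : IsPseudoDist ρ) (hS : SumBound ρ K) {A B : Matrix n n ℝ}
    (hA : Hyp56 ρ A γ₀ c₀ δ₀) (hAB : Hyp56 ρ (A + B) γ₀ c₀ δ₀) {ε : ℝ} (hε : 0 < ε) (hεc : ε ≤ c₀)
    (hB : ∀ p q, |B p q| ≤ ε * Real.exp (-(δ₀ * ρ p q))) {e : m → n} (he : Function.Injective e) (i j : m) :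
    |(A.submatrix e e)⁻¹ i j - ((A + B).submatrix e e)⁻¹ i j| ≤
      cSt K γ₀ c₀ δ₀ * (ε / c₀) ^ (dSt K γ₀ c₀ δ₀ / δ₀) * Real.exp (-(dSt K γ₀ c₀ δ₀ * ρ (e i) (e j))) := by
  set t := tPot c₀ δ₀ ε with ht
  have ht0 : 0 ≤ t := tPot_nonneg hδ hε hεc
  have h510 := (sect5_uniform hK hγ hc hδ hρ hS hA he).2.2 B (fun _ => t) hAB (fun _ => ht0)
    (fun x y => by have := hρ.nonneg x y; linarith) (hyp59_const_potential hδ hε hεc hB) i j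
  refine h510.trans (le_of_eq ?_)
  set s := dSt K γ₀ c₀ δ₀ with hs
  have hpow : Real.exp (-(s * (t + t))) = (ε / c₀) ^ (s / δ₀) := by
    rw [Real.rpow_def_of_pos (div_pos hε hc)]
    congr 1
    have hlog : Real.log (ε / c₀) = -(δ₀ * (t + t)) := by
      rw [← exp_neg_two_tPot hδ hε hεc, Real.log_exp]
    rw [hlog]
    field_simp
  rw [show -(s * (ρ (e i) (e j) + t + t)) = -(s * (t + t)) + -(s * ρ (e i) (e j)) by ring, Real.exp_add, hpow]
  ring

/-- The Hölder exponent of the printed route is at most `1/16`: `dSt = rate/4 ≤ (δ₀/4)/4`. -/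
theorem holderExponent_le (K : ℝ → ℝ) (γ₀ c₀ : ℝ) {δ₀ : ℝ} (hδ : 0 < δ₀) : dSt K γ₀ c₀ δ₀ / δ₀ ≤ 1 / 16 := by
  have h := rate_le_quarter K γ₀ c₀ (δ₀ := δ₀)
  unfold dSt
  rw [div_le_iff₀ hδ]
  linarith

/-- **The printed route is never better than the linear one**: for `0 < ε ≤ c₀` and an exponent `s ≤ 1` (here `s = dSt/δ₀ ≤ 1/16`),
`ε/c₀ ≤ (ε/c₀)^s` — the linear factor of PART 1's `perturb_rate` is dominated by the Hölder factor of the printed (5.10). -/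
theorem linear_le_holder {c₀ ε s : ℝ} (hε : 0 < ε) (hεc : ε ≤ c₀) (hs : s ≤ 1) :
    ε / c₀ ≤ (ε / c₀) ^ s := by
  have hc : 0 < c₀ := lt_of_lt_of_le hε hεc
  have hx0 : 0 < ε / c₀ := div_pos hε hc
  have hx1 : ε / c₀ ≤ 1 := by rw [div_le_one hc]; exact hεc
  have h := Real.rpow_le_rpow_of_exponent_ge hx0 hx1 hs
  rwa [Real.rpow_one] at h

/-- The two routes side by side for the printed exponent: linear factor `≤` Hölder factor (`0 < ε ≤ c₀`). -/
theorem linear_le_printed (K : ℝ → ℝ) (γ₀ : ℝ) {c₀ δ₀ ε : ℝ} (hδ : 0 < δ₀) (hε : 0 < ε) (hεc : ε ≤ c₀) :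
    ε / c₀ ≤ (ε / c₀) ^ (dSt K γ₀ c₀ δ₀ / δ₀) :=
  linear_le_holder hε hεc ((holderExponent_le K γ₀ c₀ hδ).trans (by norm_num))

end

end Summit.QuantumFields.BalabanUV.Beta.GAN24.DirichletExhaustionPrinted
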